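import Summits.QuantumFields.YangMills.Theorems.BalabanUVNodesN16TorusShift
import Summits.QuantumFields.YangMills.Theorems.BalabanUVNodesN16Thm4Print
import Literature.MathematicalPhysics.QuantumFieldTheory.Balaban1983to89.B8Prop3GaugeFixedKLevel
import HarnessLib

/-!
# Route «BalabanUVNodes» (K3 `SpineGivenEndpointR11`), DAG node N16 = NE3 — THE PERIODICITY PRINCIPLE FOR [B8] THEOREM 4 IN THE ALL-TORUS
# GEOMETRY: `Thm4TorusAt` AT PERIOD `0` (the `ℤᵈ` reading — no periodicity anywhere, uniqueness among ALL gauges) IMPLIES `Thm4TorusAt` AT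
# PERIOD `N·Lᵏ` (periodic data, periodic gauge, uniqueness among periodic gauges); N16's binder (T4ᵀ_print) from its `ℤᵈ` twin (T4^ℤᵈ_print)

Cell `pub-ymgap`, seat `pub-ymgap-dag-n16-c` (R134 fan-out seat, strategy s1; HUMAN RULING D-0062; chair R424 venue), generation 0, file 2;
`--supports stmt-QuantumFields-19676`; `bears_on: R4∕N16 · edge N05 → N16`.

WHY (FAN-OUT v1.1 §N16 s1: «state exactly what the curved ∕ {Ω_j} case still needs from N05»).  After n16-a's files 9–14 the ONLY N05-side
hypothesis of N16 is (T4ᵀ_print) = `∀ k ≥ 1, B8Thm4TorusAt.Thm4TorusAt L k (N·Lᵏ) (Lᵏ)⁻¹ c₁ unitaryUnits (Reg335Zd …) (Restr129 L k (torusLam k))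
Concl_print` ([Balaban1985RegularSpaces] Theorem 4 p. 88 for the admitted domain sequence `Ω_j = T_η`, p. 77, with PERIODIC data, a PERIODIC gauge,
a PERIODIC Lie-algebra field `A` and uniqueness among PERIODIC gauges — seat n16-b's INTERFACE-GAP-1 repair).  Node N05 and the D-0062 desk
(ME #10, stub `Thm4AllTorus`) work on the `ℤᵈ` carriers WITHOUT periodicity: data on `ℤᵈ`, a gauge on `ℤᵈ`, uniqueness among ALL unitary
gauges.  THIS FILE shows the two readings are NOT different demands: the interface at period `P = 0` — whose periodicity clauses
`t_{0·e_i}U = U` are void, so that it IS the `ℤᵈ` reading — implies the interface at any period `P` whose translations leave `Restr` and the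
conclusion covariant, because a translate of a solution is a solution and uniqueness then forces periodicity (§1); for N16's concrete binder the
covariance is file 1 (`…N16TorusShift`) and the periodicity of the Lie-algebra field follows from the principal logarithm
(`B8Prop3GaugeFixedKLevel.logField_spec`: `A = (iη)⁻¹ log U′^{u⁻¹}` once `η‖A‖ ≤ 1∕16`) (§2–§3).  So WHAT N16 NEEDS FROM N05 is exactly
(T4^ℤᵈ_print) = (T4ᵀ_print) with every periodicity clause deleted and uniqueness among all unitary gauges, in the regime `16·B·c₁ ≤ 1`.

WHAT THIS FILE PROVES (kernel, theorems only, 0 `def`, 0 sorry):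
§1 **`thm4TorusAt_of_period_zero`** (any `𝔸`, `Reg`∕`Restr`∕`Concl₀`∕`Concl` free): `Thm4TorusAt L k 0 η c₁ G Reg Restr Concl₀` ∧ [`Restr U₀ ·` and
   `Concl₀ α₀ α₁ U₀ U′ ·` covariant under `u ↦ t_{P·e_i}u` for `P·e_i`-periodic `U₀`, `U′`] ∧ [`Concl₀ → Concl` on periodic `G`-valued data in the
   window, `Concl → Concl₀`] ⟹ `Thm4TorusAt L k P η c₁ G Reg Restr Concl`.
§2 `conclZd_shiftCfg` — N16's conclusion slot WITHOUT the `A`-periodicity clause (Concl⁰_print: `∃ A` self-adjoint, `U′ = (e^{iηA})^{u}` rel. `U₀`,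
   (1.36)₁,₂, (1.38) `IsLandau138 … univ (torusLam k)`, (1.36)₃ Hölder member, (1.39)₁) is covariant under `u ↦ t_{Lᵏa}u` for `Lᵏa`-periodic data
   (file 1); `periodic_of_mgauge_cfgExp` — on `P`-periodic unitary data with a `P`-periodic unitary gauge, the field `A` of `U′ = (e^{iηA})^{u}`,
   `‖A‖ ≤ B(α₀+α₁)`, IS periodic when `η·B(α₀+α₁) ≤ 1∕16` (the upgrade Concl⁰_print ⟹ Concl_print).
§3 **`thm4TorusAt_print_of_zd`** — for every `Reg`, `k`, `N`, `0 < η ≤ 1`, `0 ≤ B`, `16·B·c₁ ≤ 1`, `L ≥ 1`: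
   `Thm4TorusAt L k 0 η c₁ unitaryUnits Reg (Restr129 L k (torusLam k)) Concl⁰_print ⟹ Thm4TorusAt L k (N·Lᵏ) η c₁ unitaryUnits Reg (Restr129 …) Concl_print`.
§4 **`n16_of_thm4Zd_print`** (`d = 4`) — file 13's `n16_of_thm4TorusAt_print` with (T4ᵀ_print) replaced by (T4^ℤᵈ_print) and the two letter lines
   `0 ≤ B`, `16·B·c₁ ≤ 1`: N16 ∕ NE3's statement of record from the `ℤᵈ` reading of Theorem 4 at the all-torus member and N07's (H3ˢᵘᵖ).
HONEST FRAMING: bookkeeping by name + an elementary symmetry argument; (T4^ℤᵈ_print) = [Balaban1985RegularSpaces] Thm 4 + Prop 3 at CURVED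
backgrounds on the `ℤᵈ` carriers at the all-torus member — node N05's theorem, NOT proved in the tree; (H3ˢᵘᵖ) = N07's [Balaban1985Variational]
Thm 1 TYPE; N16 ∕ NE3 NOT discharged; count-neutral; finite T⁴ at fixed ε — NOT ℝ⁴, NOT infinite volume, NOT OS, NOT a mass gap, NOT Clay.
-/

set_option autoImplicit false

open scoped BigOperators Matrix Matrix.Norms.L2Operator
open NormedSpace

namespace Summit.QuantumFields.YangMills.BalabanUVNodes.N16

open Literature.MathematicalPhysics.QuantumFieldTheory.Balaban1983to89
open B7Prop1Explicit B7Prop2Explicit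
open T4AveragingDeficitWall (Ad)
open B7Eq92Concrete (mgauge)
open B8Ineq132 (covDerivFwd InAk)
open B8Eq184Proof (cfgExp)
open B8Eq119TwistedAxial (Restr129 InAx)
open B8Eq133Hypotheses (Reg335Zd)
open B8Eq138LandauZd (covLap IsLandau138)
open B8Thm4TorusAt (torusLam Cond166T Thm4TorusAt)
open B12Ineq417Flat (shiftCfg shiftCfg_apply shiftCfg_zero)
open B7TranslationCovariance (mgauge_shiftCfg)
open B8Prop3GaugeFixedKLevel (eq_mgauge_inv_of_mgauge_eq mem_unitaryUnits_of_mgauge_eq logField_spec)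
open Complex (I)
open MatrixLog (mlog)
open Summit.QuantumFields.BalabanUV.T4Continuum
open BlockAverageCurrent (curConst)
open NE3EnergyWeightedCovShape (NE3EnergyRateWCov)
open NE3RightInverseSupLetters (frameC)
open NE3.LeafIndexSockets (LeafH3sup)
open MinimalActionRate (sfClass)
open TorusShift (restr129_torusLam_shiftCfg isLandau138_torusLam_shiftCfg covDerivFwd_shiftCfg covLap_shiftCfg cfgExp_shiftCfg)

noncomputable section

variable {d : ℕ}

/-! ## §1 The periodicity principle (abstract `Reg`, `Restr`, `Concl`) -/

section Abstract

variable {𝔸 : Type*} [NormedRing 𝔸] [NormOneClass 𝔸] [NormedAlgebra ℂ 𝔸] [CompleteSpace 𝔸]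

omit [NormOneClass 𝔸] in
/-- **THE PERIODICITY PRINCIPLE FOR THEOREM 4 IN THE ALL-TORUS GEOMETRY.**  Suppose Theorem 4 holds in the form `Thm4TorusAt L k 0 η c₁ G Reg Restr
Concl₀` — period `0`, i.e. NO periodicity assumed of the data, NONE asserted of the gauge, and uniqueness among ALL `G`-valued gauges with
`Restr ∧ Concl₀` (the `ℤᵈ` reading).  Suppose that for `P·e_i`-periodic data the predicates `Restr U₀ ·` and `Concl₀ α₀ α₁ U₀ U′ ·` are covariant
under translating the gauge by `P·e_i`, that `Concl₀` upgrades to `Concl` on periodic `G`-valued data with a periodic gauge (in the window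
`0 < α₀, α₁`, `α₀ + α₁ ≤ c₁`), and that `Concl → Concl₀`.  THEN `Thm4TorusAt L k P η c₁ G Reg Restr Concl`: the unique `ℤᵈ` solution is periodic
(its translate is again a solution), satisfies `Concl`, and is unique among periodic gauges with `Restr ∧ Concl`.
[cite: Balaban1985RegularSpaces, Thm 4 p.88, p.77 («we admit the case where some domains Ω_j are equal to T_η»), (1.3) p.77] -/
theorem thm4TorusAt_of_period_zero {L k : ℕ} {P : ℤ} {η c₁ : ℝ} {G : Subgroup 𝔸ˣ}
    {Reg : (Site d → Fin d → 𝔸ˣ) → Prop} {Restr : (Site d → Fin d → 𝔸ˣ) → (Site d → 𝔸ˣ) → Prop}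
    {Concl₀ Concl : ℝ → ℝ → (Site d → Fin d → 𝔸ˣ) → (Site d → Fin d → 𝔸ˣ) → (Site d → 𝔸ˣ) → Prop}
    (hT : Thm4TorusAt L k 0 η c₁ G Reg Restr Concl₀)
    (hRestr : ∀ (U₀ : Site d → Fin d → 𝔸ˣ) (u : Site d → 𝔸ˣ) (i : Fin d), shiftCfg (P • e i) U₀ = U₀ →
      Restr U₀ u → Restr U₀ (shiftCfg (P • e i) u))
    (hConcl₀ : ∀ (α₀ α₁ : ℝ) (U₀ U' : Site d → Fin d → 𝔸ˣ) (u : Site d → 𝔸ˣ) (i : Fin d), shiftCfg (P • e i) U₀ = U₀ →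
      shiftCfg (P • e i) U' = U' → Concl₀ α₀ α₁ U₀ U' u → Concl₀ α₀ α₁ U₀ U' (shiftCfg (P • e i) u))
    (hup : ∀ (α₀ α₁ : ℝ) (U₀ U' : Site d → Fin d → 𝔸ˣ) (u : Site d → 𝔸ˣ), 0 < α₀ → 0 < α₁ → α₀ + α₁ ≤ c₁ →
      (∀ x κ, U₀ x κ ∈ G) → (∀ x κ, U' x κ ∈ G) → (∀ x, u x ∈ G) →
      (∀ i : Fin d, shiftCfg (P • e i) U₀ = U₀) → (∀ i : Fin d, shiftCfg (P • e i) U' = U') →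
      (∀ (x : Site d) (i : Fin d), u (x + P • e i) = u x) → Concl₀ α₀ α₁ U₀ U' u → Concl α₀ α₁ U₀ U' u)
    (hdown : ∀ (α₀ α₁ : ℝ) (U₀ U' : Site d → Fin d → 𝔸ˣ) (u : Site d → 𝔸ˣ), Concl α₀ α₁ U₀ U' u → Concl₀ α₀ α₁ U₀ U' u) :
    Thm4TorusAt L k P η c₁ G Reg Restr Concl := by
  intro α₀ α₁ hα₀ hα₁ hc U₀ U' hU₀G hU'G hU₀P hU'P hA₀ hReg hA hAx h166
  have h0 : ∀ (V : Site d → Fin d → 𝔸ˣ) (i : Fin d), shiftCfg ((0 : ℤ) • e i) V = V := fun V i => by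
    rw [zero_smul, shiftCfg_zero]
  obtain ⟨u, ⟨huG, -, hRes, hC₀⟩, huniq⟩ :=
    hT hα₀ hα₁ hc U₀ U' hU₀G hU'G (h0 U₀) (h0 U') hA₀ hReg hA hAx h166
  -- a translate of the solution is a solution, hence equal to it: the gauge is periodic
  have hper : ∀ (x : Site d) (i : Fin d), u (x + P • e i) = u x := by
    intro x i
    have hsol := huniq (shiftCfg (P • e i) u) (fun y => huG _) (fun y j => by rw [zero_smul, add_zero])
      (hRestr U₀ u i (hU₀P i) hRes) (hConcl₀ α₀ α₁ U₀ U' u i (hU₀P i) (hU'P i) hC₀)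
    have := congr_fun hsol x
    rwa [shiftCfg_apply] at this
  refine ⟨u, ⟨huG, hper, hRes, hup α₀ α₁ U₀ U' u hα₀ hα₁ hc hU₀G hU'G huG hU₀P hU'P hper hC₀⟩, ?_⟩
  intro u' hu'G _ hRes' hC'
  exact huniq u' hu'G (fun y j => by rw [zero_smul, add_zero]) hRes' (hdown α₀ α₁ U₀ U' u' hC')

end Abstract

/-! ## §2 N16's conclusion slot: covariance of its `ℤᵈ` form and the periodicity of the Lie-algebra field -/

section Concrete

variable {n : Type*} [Fintype n] [DecidableEq n]

/-- **Concl⁰_print IS TRANSLATION COVARIANT IN THE GAUGE.**  N16's conclusion slot without the `A`-periodicity clause — `∃ A` self-adjoint with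
`U′ = (e^{iηA})^{u}` relative to `U₀` (`mgauge`), (1.36)₁ `‖A‖ ≤ B(α₀+α₁)`, (1.36)₂ `‖D^η_{U₀,μ}A_κ‖ ≤ B(α₀+α₁)`, (1.38) `IsLandau138 L k η univ
(torusLam k) U₀ A`, the (1.36)₃ Hölder member and (1.39)₁ `‖Δ^η_{U₀}A_κ‖ ≤ B(α₀+α₁)` — passes from `u` to the translate `t_v u`, `v = Lᵏ·a`, for
`v`-periodic `U₀`, `U′`, with the translated field `t_v A` (file 1's covariances). [cite: Balaban1985RegularSpaces, (1.36)–(1.38) p.82, (1.39) p.83, p.77] -/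
theorem conclZd_shiftCfg {L k : ℕ} (hL : 1 ≤ L) {η B Bh β α₀ α₁ : ℝ} {U₀ U' : Site d → Fin d → (Matrix n n ℂ)ˣ}
    {u : Site d → (Matrix n n ℂ)ˣ} {a : Site d}
    (hU₀ : shiftCfg (((L : ℤ) ^ k) • a) U₀ = U₀) (hU' : shiftCfg (((L : ℤ) ^ k) • a) U' = U')
    (h : ∃ A : Site d → Fin d → Matrix n n ℂ,
      (∀ x μ, IsSelfAdjoint (A x μ)) ∧ mgauge U₀ u (cfgExp η A) = U' ∧ (∀ x μ, ‖A x μ‖ ≤ B * (α₀ + α₁)) ∧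
      (∀ (μ : Fin d) (x : Site d) (κ : Fin d), ‖covDerivFwd η U₀ μ (fun z => A z κ) x‖ ≤ B * (α₀ + α₁)) ∧
      IsLandau138 L k η Set.univ (torusLam k) U₀ A ∧
      (∀ (μ : Fin d) (y : Site d) (κ : Fin d),
        ‖Ad (U₀ y μ) (covDerivFwd η U₀ μ (fun z => A z κ) (y + e μ)) - covDerivFwd η U₀ μ (fun z => A z κ) y‖
          ≤ Bh * (α₀ + α₁) * (((L : ℝ)⁻¹) ^ k) ^ β) ∧
      (∀ (x : Site d) (κ : Fin d), ‖covLap η U₀ (fun z => A z κ) x‖ ≤ B * (α₀ + α₁))) :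
    ∃ A : Site d → Fin d → Matrix n n ℂ,
      (∀ x μ, IsSelfAdjoint (A x μ)) ∧ mgauge U₀ (shiftCfg (((L : ℤ) ^ k) • a) u) (cfgExp η A) = U' ∧
      (∀ x μ, ‖A x μ‖ ≤ B * (α₀ + α₁)) ∧
      (∀ (μ : Fin d) (x : Site d) (κ : Fin d), ‖covDerivFwd η U₀ μ (fun z => A z κ) x‖ ≤ B * (α₀ + α₁)) ∧
      IsLandau138 L k η Set.univ (torusLam k) U₀ A ∧
      (∀ (μ : Fin d) (y : Site d) (κ : Fin d),
        ‖Ad (U₀ y μ) (covDerivFwd η U₀ μ (fun z => A z κ) (y + e μ)) - covDerivFwd η U₀ μ (fun z => A z κ) y‖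
          ≤ Bh * (α₀ + α₁) * (((L : ℝ)⁻¹) ^ k) ^ β) ∧
      (∀ (x : Site d) (κ : Fin d), ‖covLap η U₀ (fun z => A z κ) x‖ ≤ B * (α₀ + α₁)) := by
  obtain ⟨A, hsa, hmg, hs, hg, h138, hhol, hlap⟩ := h
  set v : Site d := ((L : ℤ) ^ k) • a with hv
  -- the covariant stencils of the translated field are the translated stencils (`U₀` is `v`-periodic)
  have hD : ∀ (μ κ : Fin d) (x : Site d),
      covDerivFwd η U₀ μ (fun z => shiftCfg v A z κ) x = covDerivFwd η U₀ μ (fun z => A z κ) (x + v) := by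
    intro μ κ x
    have e1 : (fun z => shiftCfg v A z κ) = shiftCfg v (fun z => A z κ) := rfl
    rw [e1]
    conv_lhs => rw [← hU₀]
    exact covDerivFwd_shiftCfg η U₀ μ _ v x
  have hΔ : ∀ (κ : Fin d) (x : Site d), covLap η U₀ (fun z => shiftCfg v A z κ) x = covLap η U₀ (fun z => A z κ) (x + v) := by
    intro κ x
    have e1 : (fun z => shiftCfg v A z κ) = shiftCfg v (fun z => A z κ) := rfl
    rw [e1]
    conv_lhs => rw [← hU₀]
    exact covLap_shiftCfg η U₀ _ v x
  have hU₀v : ∀ (y : Site d) (μ : Fin d), U₀ y μ = U₀ (y + v) μ := fun y μ => by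
    have := congr_fun (congr_fun hU₀ y) μ
    rw [shiftCfg_apply] at this
    exact this.symm
  refine ⟨shiftCfg v A, fun x μ => hsa (x + v) μ, ?_, fun x μ => hs (x + v) μ, fun μ x κ => ?_,
    isLandau138_torusLam_shiftCfg hL hU₀ h138, fun μ y κ => ?_, fun x κ => ?_⟩
  · rw [cfgExp_shiftCfg]
    conv_lhs => rw [← hU₀]
    rw [mgauge_shiftCfg, hmg, hU']
  · rw [hD]; exact hg μ (x + v) κ
  · rw [hD, hD, hU₀v y μ, add_right_comm y (e μ) v]; exact hhol μ (y + v) κ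
  · rw [hΔ]; exact hlap (x + v) κ

/-- **ON PERIODIC DATA THE LIE-ALGEBRA FIELD IS PERIODIC** (the upgrade Concl⁰_print ⟹ Concl_print): if `U₀`, `U′` are unitary and `P`-periodic,
`u` is unitary and `P`-periodic, and `U′ = (e^{iηA})^{u}` relative to `U₀` with `A` self-adjoint and `‖A‖ ≤ B(α₀+α₁)`, `η·B(α₀+α₁) ≤ 1∕16`,
`η > 0`, then `A` is `P`-periodic — `e^{iηA} = U′^{u⁻¹}` is periodic and `A = (iη)⁻¹ log` of it bondwise (principal logarithm,
`B8Prop3GaugeFixedKLevel.logField_spec`). [cite: Balaban1985RegularSpaces, (1.36) p.82, p.89 («A₀ = (1/iη) log U′»), (1.3) p.77] -/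
theorem periodic_of_mgauge_cfgExp [Nonempty n] {η B α₀ α₁ : ℝ} (hη : 0 < η) (hsmall : B * (α₀ + α₁) * η ≤ 1 / 16) {P : ℤ}
    {U₀ U' : Site d → Fin d → (Matrix n n ℂ)ˣ} {u : Site d → (Matrix n n ℂ)ˣ}
    (hU₀u : ∀ x κ, U₀ x κ ∈ unitaryUnits (Matrix n n ℂ)) (hU'u : ∀ x κ, U' x κ ∈ unitaryUnits (Matrix n n ℂ))
    (huu : ∀ x, u x ∈ unitaryUnits (Matrix n n ℂ))
    (hU₀P : ∀ i : Fin d, shiftCfg (P • e i) U₀ = U₀) (hU'P : ∀ i : Fin d, shiftCfg (P • e i) U' = U')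
    (huP : ∀ (x : Site d) (i : Fin d), u (x + P • e i) = u x)
    {A : Site d → Fin d → Matrix n n ℂ} (hmg : mgauge U₀ u (cfgExp η A) = U') (hs : ∀ x μ, ‖A x μ‖ ≤ B * (α₀ + α₁)) :
    ∀ (x : Site d) (κ μ : Fin d), A (x + P • e κ) μ = A x μ := by
  letI : CStarAlgebra (Matrix n n ℂ) := {}
  intro x κ μ
  have hW : cfgExp η A = mgauge U₀ u⁻¹ U' := eq_mgauge_inv_of_mgauge_eq hmg
  have hWu : ∀ y ν, cfgExp η A y ν ∈ unitaryUnits (Matrix n n ℂ) := mem_unitaryUnits_of_mgauge_eq hU₀u hU'u huu hmg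
  -- `e^{iηA}` is periodic
  have hWP : cfgExp η A (x + P • e κ) μ = cfgExp η A x μ := by
    have hui : shiftCfg (P • e κ) u⁻¹ = u⁻¹ := by
      funext y; show (u (y + P • e κ))⁻¹ = (u y)⁻¹; rw [huP]
    have h1 : shiftCfg (P • e κ) (cfgExp η A) = cfgExp η A := by
      rw [hW, ← mgauge_shiftCfg, hU₀P, hui, hU'P]
    have := congr_fun (congr_fun h1 x) μ
    rwa [shiftCfg_apply] at this
  -- and `A` is its bondwise principal logarithm
  have hηne : η ≠ 0 := hη.ne'
  have hA : ∀ y ν, ‖A y ν‖ ≤ (B * (α₀ + α₁) * η) * η⁻¹ := fun y ν => by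
    rw [mul_assoc, mul_inv_cancel₀ hηne, mul_one]; exact hs y ν
  have e1 := (logField_spec hη U₀ hWu (rfl : cfgExp η A (x + P • e κ) μ = cfgExp η A (x + P • e κ) μ) (hA _ _) hsmall).1
  have e2 := (logField_spec hη U₀ hWu (rfl : cfgExp η A x μ = cfgExp η A x μ) (hA _ _) hsmall).1
  rw [← e1, ← e2, hWP]

end Concrete

/-! ## §3 (T4ᵀ_print) at period `N·Lᵏ` from its `ℤᵈ` twin at period `0` -/

section Print

variable {n : Type*} [Fintype n] [DecidableEq n]

/-- **N16's BINDER FROM ITS `ℤᵈ` TWIN.**  For every `Reg`, every `k`, `N`, `0 < η ≤ 1`, Thm-4 constants with `0 ≤ B` and `16·B·c₁ ≤ 1`, `L ≥ 1`: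
if Theorem 4 holds on the `ℤᵈ` carriers at the all-torus member in N16's letters WITHOUT periodicity — `Thm4TorusAt L k 0 η c₁ unitaryUnits Reg
(Restr129 L k (torusLam k)) Concl⁰_print` (data on `ℤᵈ`, a gauge on `ℤᵈ`, unique among ALL unitary gauges; the D-0062 desk's `Thm4AllTorus`
reading) — then it holds in the all-torus geometry proper: `Thm4TorusAt L k (N·Lᵏ) η c₁ unitaryUnits Reg (Restr129 L k (torusLam k)) Concl_print`
(periodic data, periodic gauge, periodic `A`, unique among periodic gauges).  §1 with file 1's covariance of (1.29) and §2.
[cite: Balaban1985RegularSpaces, Thm 4 p.88, (1.29) p.81, (1.36)–(1.38) p.82, (1.39) p.83, p.77] -/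
theorem thm4TorusAt_print_of_zd [Nonempty n] {L : ℕ} (hL : 1 ≤ L) (k N : ℕ) {η c₁ B Bh β : ℝ} (hη : 0 < η) (hη1 : η ≤ 1)
    (hB : 0 ≤ B) (hBc : 16 * (B * c₁) ≤ 1) (Reg : (Site d → Fin d → (Matrix n n ℂ)ˣ) → Prop)
    (hT : Thm4TorusAt L k 0 η c₁ (unitaryUnits (Matrix n n ℂ)) Reg (Restr129 L k (torusLam k))
      (fun (α₀ α₁ : ℝ) (U₀ U' : Site d → Fin d → (Matrix n n ℂ)ˣ) (u : Site d → (Matrix n n ℂ)ˣ) =>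
        ∃ A : Site d → Fin d → Matrix n n ℂ,
          (∀ x μ, IsSelfAdjoint (A x μ)) ∧ mgauge U₀ u (cfgExp η A) = U' ∧ (∀ x μ, ‖A x μ‖ ≤ B * (α₀ + α₁)) ∧
          (∀ (μ : Fin d) (x : Site d) (κ : Fin d), ‖covDerivFwd η U₀ μ (fun z => A z κ) x‖ ≤ B * (α₀ + α₁)) ∧
          IsLandau138 L k η Set.univ (torusLam k) U₀ A ∧
          (∀ (μ : Fin d) (y : Site d) (κ : Fin d),
            ‖Ad (U₀ y μ) (covDerivFwd η U₀ μ (fun z => A z κ) (y + e μ)) - covDerivFwd η U₀ μ (fun z => A z κ) y‖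
              ≤ Bh * (α₀ + α₁) * (((L : ℝ)⁻¹) ^ k) ^ β) ∧
          (∀ (x : Site d) (κ : Fin d), ‖covLap η U₀ (fun z => A z κ) x‖ ≤ B * (α₀ + α₁)))) :
    Thm4TorusAt L k (((N * L ^ k : ℕ) : ℤ)) η c₁ (unitaryUnits (Matrix n n ℂ)) Reg (Restr129 L k (torusLam k))
      (fun (α₀ α₁ : ℝ) (U₀ U' : Site d → Fin d → (Matrix n n ℂ)ˣ) (u : Site d → (Matrix n n ℂ)ˣ) =>
        ∃ A : Site d → Fin d → Matrix n n ℂ,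
          (∀ x μ, IsSelfAdjoint (A x μ)) ∧ (∀ (x : Site d) (κ μ : Fin d), A (x + (((N * L ^ k : ℕ) : ℤ)) • e κ) μ = A x μ) ∧
          mgauge U₀ u (cfgExp η A) = U' ∧
          (∀ x μ, ‖A x μ‖ ≤ B * (α₀ + α₁)) ∧
          (∀ (μ : Fin d) (x : Site d) (κ : Fin d), ‖covDerivFwd η U₀ μ (fun z => A z κ) x‖ ≤ B * (α₀ + α₁)) ∧
          IsLandau138 L k η Set.univ (torusLam k) U₀ A ∧
          (∀ (μ : Fin d) (y : Site d) (κ : Fin d),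
            ‖Ad (U₀ y μ) (covDerivFwd η U₀ μ (fun z => A z κ) (y + e μ)) - covDerivFwd η U₀ μ (fun z => A z κ) y‖
              ≤ Bh * (α₀ + α₁) * (((L : ℝ)⁻¹) ^ k) ^ β) ∧
          (∀ (x : Site d) (κ : Fin d), ‖covLap η U₀ (fun z => A z κ) x‖ ≤ B * (α₀ + α₁))) := by
  -- the period vector is a multiple of `Lᵏ`: `(N·Lᵏ)·e_i = Lᵏ·(N·e_i)`
  have hP : ∀ i : Fin d, (((N * L ^ k : ℕ) : ℤ)) • (e i : Site d) = ((L : ℤ) ^ k) • ((N : ℤ) • e i) := fun i => by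
    rw [smul_smul]; push_cast; rw [mul_comm]
  refine thm4TorusAt_of_period_zero hT ?_ ?_ ?_ ?_
  · intro U₀ u i hU₀ hRes
    rw [hP] at hU₀ ⊢
    exact restr129_torusLam_shiftCfg hU₀ hRes
  · intro α₀ α₁ U₀ U' u i hU₀ hU' hC
    rw [hP] at hU₀ hU' ⊢
    exact conclZd_shiftCfg hL hU₀ hU' hC
  · intro α₀ α₁ U₀ U' u hα₀ hα₁ hc hU₀u hU'u huu hU₀P hU'P huP hC
    obtain ⟨A, hsa, hmg, hs, hg, h138, hhol, hlap⟩ := hC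
    have hsmall : B * (α₀ + α₁) * η ≤ 1 / 16 := by
      have h1 : B * (α₀ + α₁) ≤ B * c₁ := mul_le_mul_of_nonneg_left hc hB
      have h2 : 0 ≤ B * (α₀ + α₁) := mul_nonneg hB (by linarith)
      nlinarith
    exact ⟨A, hsa, periodic_of_mgauge_cfgExp hη hsmall hU₀u hU'u huu hU₀P hU'P huP hmg hs, hmg, hs, hg, h138, hhol, hlap⟩
  · rintro α₀ α₁ U₀ U' u ⟨A, hsa, -, hmg, hs, hg, h138, hhol, hlap⟩
    exact ⟨A, hsa, hmg, hs, hg, h138, hhol, hlap⟩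

end Print

/-! ## §4 The `d = 4` record knit from the `ℤᵈ` reading of Theorem 4 -/

section Knit

variable {n : Type*} [Fintype n] [DecidableEq n]

/-- **N16 · NE3 BY NAME FROM THE `ℤᵈ` READING OF [B8] THEOREM 4 AT THE ALL-TORUS MEMBER AND N07's INTERFACE** (`d = 4`; `L ≥ 2`, `N ≥ 1`): file 13's
`n16_of_thm4TorusAt_print` with its hypothesis (T4ᵀ_print) — Theorem 4 in the all-torus geometry with periodic data, periodic gauge, periodic
`A`, uniqueness among periodic gauges — REPLACED by (T4^ℤᵈ_print): `∀ k ≥ 1, Thm4TorusAt L k 0 (Lᵏ)⁻¹ c₁ unitaryUnits (Reg335Zd (Lᵏ)⁻¹ L (𝒬 k) C₃₃₅)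
(Restr129 L k (torusLam k)) Concl⁰_print` (no periodicity anywhere; uniqueness among all unitary gauges), plus the two letter lines `0 ≤ B`,
`16·B·c₁ ≤ 1` under which the Lie-algebra field is the principal logarithm.  §3 ∘ file 13 §2.  N16 ∕ NE3 NOT proved: (T4^ℤᵈ_print) is node N05's
theorem ([Balaban1985RegularSpaces] Thm 4 + Prop 3 at curved backgrounds), (H3ˢᵘᵖ) is N07's. [folklore] -/
theorem n16_of_thm4Zd_print [Nonempty n] {L N : ℕ} (hL : 2 ≤ L) (hN : 1 ≤ N) :
    ∃ r : ℝ, 0 < r ∧ ∀ ⦃g : ℝ⦄, 0 < g → ∃ C : ℝ, 0 ≤ C ∧ ∀ (c₁ B Bh : ℝ), 0 ≤ B → 16 * (B * c₁) ≤ 1 → ∀ ⦃b' c' : ℝ⦄, 0 ≤ b' → 0 ≤ c' →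
      2 ^ 15 * ((4 : ℝ) + 1) ^ 2 * ((4 : ℝ) + 4) ^ 2 * (L : ℝ) ^ 2 * b' ≤ 1 →
      23040 * (4 : ℝ) ^ 4 * (frameC 4 L + 4) ^ 3 * (c' + curConst 4 L * b' ^ 2) ≤ 1 →
      ∀ ⦃α : ℝ⦄, 0 < α → C0 4 * α ≤ 1 / 3 → 2 * α ≤ c2' 4 L → 11 * (4 : ℝ) ^ 2 * α ≤ 1 / 6 → α + 11 * (4 : ℝ) ^ 2 * α ≤ c₁ →
      b' + 226 * (8 * ((4 : ℝ) + 1) * ((4 : ℝ) + 4)) ^ 2 * b' ^ 2 < α → 4 * ((4 : ℝ) - 1) * (c' + curConst 4 L * b' ^ 2) < α →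
      ∀ ⦃Mc : ℝ⦄, 0 ≤ Mc → (Mc + 1) * (b' + 226 * (8 * ((4 : ℝ) + 1) * ((4 : ℝ) + 4)) ^ 2 * b' ^ 2) ≤ 1 / 2 →
      ∀ (𝒬 : ℕ → Set (Set (Site 4) × ℕ)), (∀ k, ∀ q ∈ 𝒬 k, q.2 ≤ k ∧ ∃ y : Site 4, ∀ z ∈ q.1, (l1 (z - y) : ℝ) ≤ Mc * (L : ℝ) ^ q.2) →
      ∀ ⦃C335 : ℝ⦄, 2 * (Mc + 1) * (b' + 226 * (8 * ((4 : ℝ) + 1) * ((4 : ℝ) + 4)) ^ 2 * b' ^ 2) + 2 * Mc * (2 * (c' + curConst 4 L * b' ^ 2)) +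
        4 * Mc * (1 + 2 * Mc) * (b' + 226 * (8 * ((4 : ℝ) + 1) * ((4 : ℝ) + 4)) ^ 2 * b' ^ 2) ^ 2 < C335 →
      ∀ ⦃ε s₁ b s₂ : ℝ⦄, 0 < ε → ε ≤ r → ε < α → 0 ≤ s₁ → s₁ ≤ r → 0 ≤ b → b ≤ ε / 2 →
      B * (α + 11 * (4 : ℝ) ^ 2 * α) ≤ s₁ →
      B * (α + 11 * (4 : ℝ) ^ 2 * α) + 2 * (b' + 226 * (8 * ((4 : ℝ) + 1) * ((4 : ℝ) + 4)) ^ 2 * b' ^ 2) * s₁ ≤ s₁ →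
      B * (α + 11 * (4 : ℝ) ^ 2 * α) + 16 * (b' + 226 * (8 * ((4 : ℝ) + 1) * ((4 : ℝ) + 4)) ^ 2 * b' ^ 2) * (B * (α + 11 * (4 : ℝ) ^ 2 * α)) ≤ s₁ →
      Bh * (α + 11 * (4 : ℝ) ^ 2 * α) + 8 * (b' + 226 * (8 * ((4 : ℝ) + 1) * ((4 : ℝ) + 4)) ^ 2 * b' ^ 2) * (B * (α + 11 * (4 : ℝ) ^ 2 * α)) ≤ s₂ →
      (∀ k, 1 ≤ k → Thm4TorusAt L k 0 (((L : ℝ) ^ k)⁻¹) c₁ (unitaryUnits (Matrix n n ℂ))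
        (Reg335Zd (((L : ℝ) ^ k)⁻¹) L (𝒬 k) C335) (Restr129 L k (torusLam k))
        (fun (α₀ α₁ : ℝ) (U₀ U' : Site 4 → Fin 4 → (Matrix n n ℂ)ˣ) (u : Site 4 → (Matrix n n ℂ)ˣ) =>
          ∃ A : Site 4 → Fin 4 → Matrix n n ℂ,
            (∀ x μ, IsSelfAdjoint (A x μ)) ∧ mgauge U₀ u (cfgExp (((L : ℝ) ^ k)⁻¹) A) = U' ∧
            (∀ x μ, ‖A x μ‖ ≤ B * (α₀ + α₁)) ∧
            (∀ (μ : Fin 4) (x : Site 4) (κ : Fin 4), ‖covDerivFwd (((L : ℝ) ^ k)⁻¹) U₀ μ (fun z => A z κ) x‖ ≤ B * (α₀ + α₁)) ∧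
            IsLandau138 L k (((L : ℝ) ^ k)⁻¹) Set.univ (torusLam k) U₀ A ∧
            (∀ (μ : Fin 4) (y : Site 4) (κ : Fin 4),
              ‖Ad (U₀ y μ) (covDerivFwd (((L : ℝ) ^ k)⁻¹) U₀ μ (fun z => A z κ) (y + e μ)) - covDerivFwd (((L : ℝ) ^ k)⁻¹) U₀ μ (fun z => A z κ) y‖
                ≤ Bh * (α₀ + α₁) * (((L : ℝ)⁻¹) ^ k) ^ (1 : ℝ)) ∧
            (∀ (x : Site 4) (κ : Fin 4), ‖covLap (((L : ℝ) ^ k)⁻¹) U₀ (fun z => A z κ) x‖ ≤ B * (α₀ + α₁)))) →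
      ∀ {dom : _root_.Set (Site 4 → Fin 4 → (Matrix n n ℂ)ˣ)},
        LeafH3sup 4 L N ε b' c' dom →
        NE3EnergyRateWCov 4 (sfClass 4 L N ε) L N b g C s₁ s₂ dom := by
  have hL1 : 1 ≤ L := by omega
  obtain ⟨r, hr0, hr⟩ := n16_of_thm4TorusAt_print (n := n) hL hN
  refine ⟨r, hr0, fun g hg => ?_⟩
  obtain ⟨C, hC0, hC⟩ := hr hg
  refine ⟨C, hC0, fun c₁ B Bh hB hBc b' c' hb' hc' hRb hcF α hα hA3 hA2 hAs hAc hb'α hc'α Mc hMc hMcα 𝒬 h𝒬 C335 hC335 ε s₁ b s₂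
    hε hεr hεα hs₁ hs₁r hb hbh hss hgrad hℓ hhol hT0 dom h3 => ?_⟩
  have hηk : ∀ k : ℕ, 0 < ((L : ℝ) ^ k)⁻¹ ∧ ((L : ℝ) ^ k)⁻¹ ≤ 1 := fun k => by
    have hL1r : (1 : ℝ) ≤ L := by exact_mod_cast hL1
    have hLk : (1 : ℝ) ≤ (L : ℝ) ^ k := one_le_pow₀ hL1r
    exact ⟨by positivity, inv_le_one_of_one_le₀ hLk⟩
  exact hC c₁ B Bh hb' hc' hRb hcF hα hA3 hA2 hAs hAc hb'α hc'α hMc hMcα 𝒬 h𝒬 hC335 hε hεr hεα hs₁ hs₁r hb hbh hss hgrad hℓ hhol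
    (fun k hk => thm4TorusAt_print_of_zd hL1 k N (hηk k).1 (hηk k).2 hB hBc _ (hT0 k hk)) h3

end Knit

end

end Summit.QuantumFields.YangMills.BalabanUVNodes.N16
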